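import Summits.Ventures.AbcSig.Rows.TemplateC
import Summits.Ventures.AbcSig.Levels.N98

/-!
# Venture AbcSig — ROW `XnYn7Z2Even`: `xⁿ + yⁿ = 7 z²` (`xy` even) (GENERATED by plean/leanrow.py)

HONEST FRAMING. A row of a COMPUTATION cell (`pub-abcsig`); a CONDITIONAL theorem, no claim on ABC or any summit.
Hypotheses: `BS04Package` (CITED: [BS04] Lemma 3.3 + (3.1) + Lemma 4.2), `DataComplete` at the level(s)
98 (COMPUTED, two-engine certified level files), and the listed per-orbit
exclusions `hX_…` (CITED; the row's R5 cell names the printed argument for each). Everything else is kernel-checked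
(`Rows/TemplateC.lean`, `Levels/N….lean`). Exponent range: prime `n ≥ 11`.
Cell row: the xy-even half of census/rows/C7/C7-partial-4z.md (referee-SIGNED 2026-08-22T06:54:55Z): [BS04, p. 44] says the xy-even case of C = 7 is resolvable by their methods (level 98); the obstruction is xy odd (level 1568, j = -64 forms). The excluded orbit 98.1 is the rational newform of level 98 that is a quadratic twist of 14a, potentially multiplicative at 7 (v_7(j) < 0), hence excluded by [BS04, Prop. 4.4] (odd prime 7 | C) - CITED as hX_orbit_98_1; orbit 98.2 (quadratic) is kernel-eliminated for every prime n != 7 (residual 7 only).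
-/

namespace Summit.Ventures.AbcSig

/-- Row `XnYn7Z2Even`: no primitive solution of `xⁿ + yⁿ = 7 z²` with `xy` even for prime `n ≥ 11`,
conditional on the named hypotheses. -/
theorem row_XnYn7Z2Even (M : NewformModel) (hP : M.BS04Package)
    (hD98 : M.DataComplete 98 level98Orbits)
    (n : ℕ) (hn : n.Prime) (hmin : 11 ≤ n)
    (hX_orbit_98_1 : M.Excludes 98 orbit_98_1 (fun S => S.A = 1 ∧ S.B = 1 ∧ S.C = 7 ∧ S.n = n ∧ 2 ∣ S.a * S.b))
    (a b c : ℤ) (hpar : 2 ∣ a * b) : ¬ IsPrimitiveSolution 1 1 7 n a b c := by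
  have h7 : 7 ≤ n := by omega
  have hC : Nat.Prime 7 := by norm_num
  have hnC : ¬ n ∣ 7 := by
    intro h
    rcases (Nat.dvd_prime hC).mp h with h1 | h1
    · exact hn.one_lt.ne' h1
    · omega
  exact row_template_even 7 (Nat.prime_iff.mp hC).squarefree (by decide) M hP hD98 n hn h7 hnC
    (level98_sieve n hn h7 (fun o => M.Excludes 98 o
      (fun S => S.A = 1 ∧ S.B = 1 ∧ S.C = 7 ∧ S.n = n ∧ 2 ∣ S.a * S.b)) hX_orbit_98_1 (fun h => absurd h (by simp only [List.mem_cons, List.not_mem_nil, or_false]; omega)))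
    a b c hpar

end Summit.Ventures.AbcSig
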